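import Summits.ValiantsHypothesis.ValiantsHypothesis.Theorems.SymPencilPerFourCrossSix
import Summits.ValiantsHypothesis.ValiantsHypothesis.Theorems.SymPencilPerFourCrossSixFront
import Summits.ValiantsHypothesis.ValiantsHypothesis.Theorems.SymPencilPerFourCrossSixFrontTwentySeven
import Summits.ValiantsHypothesis.ValiantsHypothesis.Theorems.SymPencilPerFourCrossSixEndgame
import Summits.ValiantsHypothesis.ValiantsHypothesis.Theorems.SymPencilBasePointDetConst

/-!
# Route `SymPencil` — row `r = 10` of the size-`28` table: the threshold-shifted declarations of
# `SymPencilPerFourCrossSix` (`--supports` stmt-ValiantsHypothesis-5674 `SdcSuperquadratic`; rung currency only)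

The declarations below (suffix `_m28`) are those of the landed `…Theorems.SymPencilPerFourCrossSix` whose meaning
changes when its numerical thresholds move by one unit — `Fin 6 → Fin 7` square families /
`|ι'| ≤ 26 → ≤ 27` / `m ≤ 27 → m ≤ 28`, as applicable — with proofs VERBATIM; unchanged
declarations are used from the original module by name (same namespace).  Why it elaborates
(m = 28 table audit, val-lit-p6 g17, 2026-08-29; reader of record val-idea-crit-5 g4, probe P31):
the leaves of the `(10, 6)` chain are stated for `card ι < 8` / `< 9`, and every size lever reads
`4·rk bL ≤ 2·dim K + |ι'|` through integer division — one unit of slack throughout.  The `_m28`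
statements imply the landed ones.

Honest framing: part of ONE row (cell `(10, 6, 7)`) of the size-`28` table; nothing about
`sdc(per_4)` follows here; `28 ≤ sdc(per_4) ≤ 29` of record, the crux `SdcSuperquadratic` and
`VP ≠ VNP` untouched.  Credit: mathematics and proof text of `SymPencilPerFourCrossSix` (its authors); this file only
moves the bound.  No definitions, no named facts. [folklore]
-/

noncomputable section

-- single-conjunct layout: Sub = Summit, duplicated namespace component intended
set_option linter.dupNamespace false

namespace Summit.ValiantsHypothesis.ValiantsHypothesis.Theorems.SymPencilPerFourCrossSix

open Matrix MvPolynomial Module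
open Literature.Computability.AlgebraicComplexity
open Summit.ValiantsHypothesis.ValiantsHypothesis.Theorems.SymPencilLagrangianKernel
open Summit.ValiantsHypothesis.ValiantsHypothesis.Theorems.SymPencilBasePointMoments
open Summit.ValiantsHypothesis.ValiantsHypothesis.Theorems.SymPencilPerFourCrossSixForms
open Summit.ValiantsHypothesis.ValiantsHypothesis.Theorems.SymPencilPerFourCrossSixFront
open Summit.ValiantsHypothesis.ValiantsHypothesis.Theorems.SymPencilPerFourCrossSixQuadratic
open Summit.ValiantsHypothesis.ValiantsHypothesis.Theorems.SymPencilPerFourCrossSixEndgame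
open Summit.ValiantsHypothesis.ValiantsHypothesis.Theorems.SymPencilBasePointDetConst

universe u

variable {k : Type u} [Field k] [CharZero k] {ι' : Type*} [Fintype ι'] [DecidableEq ι']

/-- **The cross space `V×` is not the kernel space of a size-`27` symmetric representation of
`per_4`** (base-point package form, with the determinant constancy `det (D + t CL v) = det D`
along the kernel as a hypothesis).  See the module docstring. [folklore] -/
theorem false_of_ker_eq_cross_m28 {D : Matrix ι' ι' k} (hD : IsUnit D.det) (hDs : Dᵀ = D)
    (bL : (Fin 4 × Fin 4 → k) →ₗ[k] (ι' → k)) (CL : (Fin 4 × Fin 4 → k) →ₗ[k] Matrix ι' ι' k)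
    (hCs : ∀ z, (CL z)ᵀ = CL z) {κ : k} (hκ : κ ≠ 0)
    (hii : ∀ z, bL z ⬝ᵥ (D⁻¹ * CL z * D⁻¹) *ᵥ bL z = 0)
    (hN : ∀ v, bL v = 0 → IsUnit (D + CL v).det ∧ ∀ (z : Fin 4 × Fin 4 → k) (s : k),
      κ * MvPolynomial.eval (v + s • z) (perPoly (Fin 4) k) =
        (Matrix.fromBlocks ((s * 0) • (1 : Matrix Unit Unit k))
          (Matrix.replicateRow Unit (s • bL z)) (Matrix.replicateCol Unit (s • bL z))
          (D + CL v + s • CL z)).det)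
    (hker : ∀ x : Fin 4 × Fin 4 → k,
      bL x = 0 ↔ ∀ z : Fin 4 × Fin 4, ¬ (z.1 = 0 ∨ z = (1, 0) ∨ z = (2, 0)) → x z = 0)
    (h10 : 10 ≤ finrank k (LinearMap.range bL)) (hcard : Fintype.card ι' ≤ 27)
    (hdet : ∀ v, bL v = 0 → ∀ t : k, (D + t • CL v).det = D.det) : False := by
  classical
  have hDis : (D⁻¹)ᵀ = D⁻¹ := by rw [Matrix.transpose_nonsing_inv, hDs]
  -- the cubic `F(ω, r) = ω q(r)`
  set A₃ : Matrix (Fin 3) (Fin 3) k := Matrix.of ![![0, 1, 1], ![1, 0, 1], ![1, 1, 0]] with hA₃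
  let q : (Fin 2 × Fin 3 → k) → k := fun r => ∑ i, ∑ j, r (0, i) * A₃ i j * r (1, j)
  have hq : ∀ r, q r = ∑ i, ∑ j, r (0, i) * A₃ i j * r (1, j) := fun r => rfl
  have hq' : ∀ r : Fin 2 × Fin 3 → k, q r = r (0, 0) * (r (1, 1) + r (1, 2)) +
      r (0, 1) * (r (1, 0) + r (1, 2)) + r (0, 2) * (r (1, 0) + r (1, 1)) := fun r => by
    simp only [hq, hA₃, Fin.sum_univ_three]
    simp; ring
  let β : (Fin 2 × Fin 3 → k) → (Fin 2 × Fin 3 → k) → k := fun r s =>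
    ∑ i, ∑ j, (r (0, i) * A₃ i j * s (1, j) + s (0, i) * A₃ i j * r (1, j))
  have hβ : ∀ r s, β r s = ∑ i, ∑ j, (r (0, i) * A₃ i j * s (1, j) + s (0, i) * A₃ i j * r (1, j)) :=
    fun r s => rfl
  have hA₃s : A₃ᵀ = A₃ := by
    rw [hA₃]; ext i j; fin_cases i <;> fin_cases j <;> simp [Matrix.transpose_apply]
  have hA₃u : IsUnit A₃.det := by
    rw [hA₃, Matrix.det_fin_three]; simp
  -- the direction `a` and the embedding of `X₀`
  set a : Fin 4 × Fin 4 → k := fun z =>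
    (Matrix.of ![![0, 1, 1, 1], ![0, 0, 0, 0], ![0, 0, 0, 0], ![0, 0, 0, 0]]) z.1 z.2 with ha
  have ha_ker : ∀ t : k, bL (t • a) = 0 := fun t =>
    (hker _).2 fun z hz => cross_a_off_row t z.1 z.2 fun h => hz (Or.inl h)
  let embX : (k × (Fin 2 × Fin 3 → k)) →ₗ[k] (Fin 4 × Fin 4 → k) :=
    { toFun := fun x z => (Matrix.of ![![0, 0, 0, 0], ![0, x.2 (0, 0), x.2 (0, 1), x.2 (0, 2)],
        ![0, x.2 (1, 0), x.2 (1, 1), x.2 (1, 2)], ![x.1, 0, 0, 0]]) z.1 z.2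
      map_add' := fun x y => by
        funext z; obtain ⟨i, j⟩ := z
        fin_cases i <;> fin_cases j <;> simp
      map_smul' := fun c x => by
        funext z; obtain ⟨i, j⟩ := z
        fin_cases i <;> fin_cases j <;> simp }
  have hembX : ∀ x : k × (Fin 2 × Fin 3 → k), embX x = fun z : Fin 4 × Fin 4 =>
      (Matrix.of ![![0, 0, 0, 0], ![0, x.2 (0, 0), x.2 (0, 1), x.2 (0, 2)],
        ![0, x.2 (1, 0), x.2 (1, 1), x.2 (1, 2)], ![x.1, 0, 0, 0]]) z.1 z.2 := fun _ => rfl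
  -- `f = bL ∘ embX` is injective
  set f : (k × (Fin 2 × Fin 3 → k)) →ₗ[k] (ι' → k) := bL ∘ₗ embX with hfdef
  have hf : ∀ x, f x = bL (embX x) := fun x => rfl
  have hfinj : Function.Injective f := by
    rw [← LinearMap.ker_eq_bot, Submodule.eq_bot_iff]
    intro x hx
    rw [LinearMap.mem_ker, hf] at hx
    have h := (hker _).1 hx
    have hval : ∀ i j : Fin 4, ¬ (i = 0 ∨ ((i, j) : Fin 4 × Fin 4) = (1, 0) ∨
        ((i, j) : Fin 4 × Fin 4) = (2, 0)) →
        (Matrix.of ![![0, 0, 0, 0], ![0, x.2 (0, 0), x.2 (0, 1), x.2 (0, 2)],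
          ![0, x.2 (1, 0), x.2 (1, 1), x.2 (1, 2)], ![x.1, 0, 0, 0]]) i j = 0 :=
      fun i j hij => h (i, j) hij
    have h30 : x.1 = 0 := by simpa using hval 3 0 (by simp)
    have h11 : x.2 (0, 0) = 0 := by simpa using hval 1 1 (by simp)
    have h12 : x.2 (0, 1) = 0 := by simpa using hval 1 2 (by simp)
    have h13 : x.2 (0, 2) = 0 := by simpa using hval 1 3 (by simp)
    have h21 : x.2 (1, 0) = 0 := by simpa using hval 2 1 (by simp)
    have h22 : x.2 (1, 1) = 0 := by simpa using hval 2 2 (by simp)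
    have h23 : x.2 (1, 2) = 0 := by simpa using hval 2 3 (by simp)
    clear_value embX f
    refine Prod.ext h30 (funext fun p => ?_)
    obtain ⟨i, j⟩ := p
    rw [Prod.snd_zero, Pi.zero_apply]
    fin_cases i <;> fin_cases j <;> simp [h11, h12, h13, h21, h22, h23]
  -- the transported operator `K'` with `f (K' x) = C(a) D⁻¹ f x`
  have hinv : ∀ x, CL a *ᵥ (D⁻¹ *ᵥ f x) ∈ LinearMap.range f := by
    rintro ⟨ω, r⟩
    obtain ⟨ω', r', h⟩ := SymPencilPerFourCrossSixFrontTwentySeven.cross_front hD hDs bL CL hCs hκ hii hN hker h10 hcard ω r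
    refine ⟨(ω', r'), ?_⟩
    rw [hf, hembX, hf, hembX]
    exact h.symm
  let e : (k × (Fin 2 × Fin 3 → k)) ≃ₗ[k] LinearMap.range f := LinearEquiv.ofInjective f hfinj
  have he : ∀ x, (e x : ι' → k) = f x := fun x => rfl
  let g : (k × (Fin 2 × Fin 3 → k)) →ₗ[k] LinearMap.range f :=
    LinearMap.codRestrict _ ((CL a).mulVecLin ∘ₗ (D⁻¹).mulVecLin ∘ₗ f) fun x => hinv x
  have hg : ∀ x, (g x : ι' → k) = CL a *ᵥ (D⁻¹ *ᵥ f x) := fun x => rfl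
  let K' : (k × (Fin 2 × Fin 3 → k)) →ₗ[k] (k × (Fin 2 × Fin 3 → k)) := e.symm.toLinearMap ∘ₗ g
  have hK' : ∀ x, f (K' x) = CL a *ᵥ (D⁻¹ *ᵥ f x) := by
    intro x
    have h1 : (e (e.symm (g x)) : ι' → k) = (g x : ι' → k) := by rw [e.apply_symm_apply]
    rw [he, hg] at h1
    exact h1
  -- the vector `u`, the form `Θ`
  let u : (k × (Fin 2 × Fin 3 → k)) → (ι' → k) := fun x => D⁻¹ *ᵥ f x
  have hu : ∀ x, u x = D⁻¹ *ᵥ f x := fun x => rfl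
  have hDu : ∀ x, D *ᵥ u x = f x := fun x => by
    rw [hu, Matrix.mulVec_mulVec, Matrix.mul_nonsing_inv _ hD, Matrix.one_mulVec]
  set Cm : (k × (Fin 2 × Fin 3 → k)) →ₗ[k] Matrix ι' ι' k := CL ∘ₗ embX with hCmdef
  have hCm : ∀ y, Cm y = CL (embX y) := fun y => rfl
  have hΘ0 : ∀ x, u x ⬝ᵥ Cm x *ᵥ u x = 0 := fun x => by
    have h := hii (embX x)
    rwa [sandwich₂_eq hDis] at h
  -- the base-point identity along `t ↦ t a`, read on the point `x + t K' x`
  have hmain : ∀ (x : k × (Fin 2 × Fin 3 → k)) (t : k),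
      D.det * (t * (u x ⬝ᵥ Cm (K' x) *ᵥ u x)) =
        κ * t * ((x + t • K' x).1 * q (x + t • K' x).2) := by
    intro x t
    obtain ⟨hNt, hdet'⟩ := hN (t • a) (ha_ker t)
    set y := x + t • K' x with hy
    set z : Fin 4 × Fin 4 → k := embX y with hz
    have hbz : bL z = (D + CL (t • a)) *ᵥ u x := by
      rw [hz, ← hf, hy, map_add, map_smul, hK', map_smul, Matrix.add_mulVec, hDu,
        Matrix.smul_mulVec, hu]
    have hNs : (D + CL (t • a))ᵀ = D + CL (t • a) := by
      rw [Matrix.transpose_add, hDs, hCs]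
    have hper : ∀ s : k, MvPolynomial.eval (t • a + s • z) (perPoly (Fin 4) k) =
        s ^ 3 * (t * (y.1 * q y.2)) := fun s => by
      rw [hz, hembX, ha, eval_cross_pencil, hq']
    have hE : ∀ s : k, (Matrix.fromBlocks ((s * 0) • (1 : Matrix Unit Unit k))
        (Matrix.replicateRow Unit (s • (D + CL (t • a)) *ᵥ u x))
        (Matrix.replicateCol Unit (s • (D + CL (t • a)) *ᵥ u x))
        (D + CL (t • a) + s • CL z)).det =
        s ^ 3 * (κ * t * (y.1 * q y.2)) + s ^ 4 * 0 := by
      intro s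
      rw [← hbz, ← hdet' z s, hper]
      ring
    obtain ⟨-, -, h3⟩ := basepoint_moment hNt hNs 0 _ 0 (u x) hE
    have hq2 : u x ⬝ᵥ CL z *ᵥ u x = t * (u x ⬝ᵥ Cm (K' x) *ᵥ u x) := by
      rw [hz, ← hCm, hy, map_add, map_smul, Matrix.add_mulVec, dotProduct_add, hΘ0, zero_add,
        Matrix.smul_mulVec, dotProduct_smul, smul_eq_mul]
    rw [hq2, map_smul, hdet a (by simpa using ha_ker 1) t] at h3
    exact h3
  -- flow invariance and NC1 from four values of `t`
  have hflowNC : ∀ x : k × (Fin 2 × Fin 3 → k),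
      (∀ t : k, (x + t • K' x).1 * q (x + t • K' x).2 = x.1 * q x.2) ∧
        D.det * (u x ⬝ᵥ Cm (K' x) *ᵥ u x) = κ * (x.1 * q x.2) := by
    intro x
    have hexp : ∀ t : k, (x + t • K' x).1 * q (x + t • K' x).2 =
        x.1 * q x.2 + (((K' x).1 * q x.2 + x.1 * β x.2 (K' x).2) * t +
          ((K' x).1 * β x.2 (K' x).2 + x.1 * q (K' x).2) * t ^ 2 +
          ((K' x).1 * q (K' x).2) * t ^ 3) := by
      intro t
      rw [Prod.fst_add, Prod.snd_add, Prod.smul_fst, Prod.smul_snd, smul_eq_mul,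
        q_add_smul A₃ q β hq hβ]
      ring
    have hval : ∀ t : k, t ≠ 0 →
        D.det * (u x ⬝ᵥ Cm (K' x) *ᵥ u x) - κ * (x.1 * q x.2) =
          κ * (((K' x).1 * q x.2 + x.1 * β x.2 (K' x).2) * t +
            ((K' x).1 * β x.2 (K' x).2 + x.1 * q (K' x).2) * t ^ 2 +
            ((K' x).1 * q (K' x).2) * t ^ 3) := by
      intro t ht
      have h := hmain x t
      rw [hexp] at h
      have h' : t * (D.det * (u x ⬝ᵥ Cm (K' x) *ᵥ u x) - κ * (x.1 * q x.2) -
          κ * (((K' x).1 * q x.2 + x.1 * β x.2 (K' x).2) * t +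
            ((K' x).1 * β x.2 (K' x).2 + x.1 * q (K' x).2) * t ^ 2 +
            ((K' x).1 * q (K' x).2) * t ^ 3)) = 0 := by
        linear_combination h
      have := (mul_eq_zero.1 h').resolve_left ht
      linear_combination this
    obtain ⟨hE, hc1, hc2, hc3⟩ := cubic_four_values hκ (hval 1 one_ne_zero)
      (hval (-1) (by norm_num)) (hval 2 two_ne_zero) (hval (-2) (by norm_num))
    refine ⟨fun t => ?_, by linear_combination hE⟩
    rw [hexp, hc1, hc2, hc3]; ring
  exact false_of_cross_endgame A₃ q β hA₃s hA₃u hq hβ K' u Cm hκ (fun x t => (hflowNC x).1 t)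
    (fun x => (hflowNC x).2)
/-- **Algebraically closed form**: over an algebraically closed field of characteristic `0`, the
cross space `V×` is not the kernel space of a size-`≤ 27` base-point package with
`dim (im bL) ≥ 10` (the determinant constancy is automatic,
`SymPencilBasePointDetConst.det_add_smul_eq_det_of_isAlgClosed`). [folklore] -/
theorem false_of_ker_eq_cross_of_isAlgClosed_m28 [IsAlgClosed k] {D : Matrix ι' ι' k}
    (hD : IsUnit D.det) (hDs : Dᵀ = D)
    (bL : (Fin 4 × Fin 4 → k) →ₗ[k] (ι' → k)) (CL : (Fin 4 × Fin 4 → k) →ₗ[k] Matrix ι' ι' k)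
    (hCs : ∀ z, (CL z)ᵀ = CL z) {κ : k} (hκ : κ ≠ 0)
    (hii : ∀ z, bL z ⬝ᵥ (D⁻¹ * CL z * D⁻¹) *ᵥ bL z = 0)
    (hN : ∀ v, bL v = 0 → IsUnit (D + CL v).det ∧ ∀ (z : Fin 4 × Fin 4 → k) (s : k),
      κ * MvPolynomial.eval (v + s • z) (perPoly (Fin 4) k) =
        (Matrix.fromBlocks ((s * 0) • (1 : Matrix Unit Unit k))
          (Matrix.replicateRow Unit (s • bL z)) (Matrix.replicateCol Unit (s • bL z))
          (D + CL v + s • CL z)).det)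
    (hker : ∀ x : Fin 4 × Fin 4 → k,
      bL x = 0 ↔ ∀ z : Fin 4 × Fin 4, ¬ (z.1 = 0 ∨ z = (1, 0) ∨ z = (2, 0)) → x z = 0)
    (h10 : 10 ≤ finrank k (LinearMap.range bL)) (hcard : Fintype.card ι' ≤ 27) : False :=
  false_of_ker_eq_cross_m28 hD hDs bL CL hCs hκ hii hN hker h10 hcard fun v hv t =>
    det_add_smul_eq_det_of_isAlgClosed D bL CL (fun w hw => (hN w hw).1) v hv t
end Summit.ValiantsHypothesis.ValiantsHypothesis.Theorems.SymPencilPerFourCrossSix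

end
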